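import Mathlib.MeasureTheory.Integral.IntervalIntegral.FundThmCalculus
import Mathlib.MeasureTheory.Integral.IntervalIntegral.IntegrationByParts
import Mathlib.Analysis.Calculus.Deriv.Pow
import Mathlib.Analysis.Calculus.Deriv.Mul
import Mathlib.Tactic

/-!
# Zhang (2022) detector census — certificate arithmetic, generic part II: the telescoping (FTC) step in real coordinates

Y. Zhang, *Discrete mean estimates and the Landau–Siegel zero*, arXiv:2211.02515 [Zhang2022LandauSiegel] — an unrefereed
manuscript under adjudication; NOTHING here is a claim about its theorems or about zeros. Cell landau-siegel §E (ls-barrier-num),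
companion of `DetectorShiftCertBernstein.lean` (p465888/p467030) and `DetectorCertSchur.lean` (p466858): the per-`b` certificates for
`Det.FormDet (Det.shiftRecipe b)` integrate `d/dτ (x* K x)` along a one-sided profile path `x = (R′, R)` (right-differentiable, the
`KinkedProfile` shape) against a `C¹` Hermitian matrix `K = [[k₁₁, p + iq],[p − iq, k₂₂]]`. THIS FILE states that derivative in real
coordinates (`R″ = a₁ + ib₁`, `R′ = a₂ + ib₂`, `R = a₃ + ib₃`) and proves `∫₀ᵀ (x*Kx)′ = (x*Kx)(T) − (x*Kx)(0)` from right-derivatives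
(`intervalIntegral.integral_eq_sub_of_hasDeriv_right_of_le`). Elementary calculus, tagged with Prop 7.1 only because the paths it
serves are that proposition's coefficient profiles.
-/

noncomputable section

open Set MeasureTheory intervalIntegral

namespace Literature.NumberTheory.LFunctions.Zhang2022.Det.ShiftCert

/-- The boundary quadratic form `x* K x` in real coordinates: `x = (a₂ + i b₂, a₃ + i b₃)`, `K = [[k₁₁, p + iq],[p − iq, k₂₂]]`.
[cite: Zhang2022LandauSiegel, Prop 7.1 p.44, (8.11)–(8.12)] -/
def bdryForm (k11 k22 p q a2 b2 a3 b3 : ℝ) : ℝ :=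
  k11 * (a2 ^ 2 + b2 ^ 2) + k22 * (a3 ^ 2 + b3 ^ 2) + 2 * (a2 * p * a3 + b2 * q * a3 - a2 * q * b3 + b2 * p * b3)

/-- Its derivative along the path (`a₃′ = a₂`, `a₂′ = a₁`, same for `b`; `k₁₁′ = dk₁₁`, `p′ = dp`, `q′ = dq`, `k₂₂′ = dk₂₂`).
[cite: Zhang2022LandauSiegel, Prop 7.1 p.44, (8.11)–(8.12)] -/
def bdryFormDeriv (k11 k22 p q dk11 dk22 dp dq a1 b1 a2 b2 a3 b3 : ℝ) : ℝ :=
  dk11 * (a2 ^ 2 + b2 ^ 2) + 2 * k11 * (a2 * a1 + b2 * b1) + dk22 * (a3 ^ 2 + b3 ^ 2) + 2 * k22 * (a3 * a2 + b3 * b2)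
    + 2 * (a1 * p * a3 + a2 * dp * a3 + a2 * p * a2 + b1 * q * a3 + b2 * dq * a3 + b2 * q * a2
           - a1 * q * b3 - a2 * dq * b3 - a2 * q * b2 + b1 * p * b3 + b2 * dp * b3 + b2 * p * b2)

/-- Pointwise right-derivative of `x*Kx` along the path. [cite: Zhang2022LandauSiegel, Prop 7.1 p.44, (8.11)–(8.12)] -/
theorem hasDerivWithinAt_bdryForm {k11 k22 p q dk11 dk22 dp dq a1 b1 a2 b2 a3 b3 : ℝ → ℝ} {t : ℝ}
    (hk11 : HasDerivAt k11 (dk11 t) t) (hk22 : HasDerivAt k22 (dk22 t) t)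
    (hp : HasDerivAt p (dp t) t) (hq : HasDerivAt q (dq t) t)
    (ha3 : HasDerivWithinAt a3 (a2 t) (Ioi t) t) (hb3 : HasDerivWithinAt b3 (b2 t) (Ioi t) t)
    (ha2 : HasDerivWithinAt a2 (a1 t) (Ioi t) t) (hb2 : HasDerivWithinAt b2 (b1 t) (Ioi t) t) :
    HasDerivWithinAt (fun t => bdryForm (k11 t) (k22 t) (p t) (q t) (a2 t) (b2 t) (a3 t) (b3 t))
      (bdryFormDeriv (k11 t) (k22 t) (p t) (q t) (dk11 t) (dk22 t) (dp t) (dq t) (a1 t) (b1 t) (a2 t) (b2 t) (a3 t) (b3 t))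
      (Ioi t) t := by
  have e11 := hk11.hasDerivWithinAt (s := Ioi t)
  have e22 := hk22.hasDerivWithinAt (s := Ioi t)
  have ep := hp.hasDerivWithinAt (s := Ioi t)
  have eq' := hq.hasDerivWithinAt (s := Ioi t)
  have h2a : HasDerivWithinAt (fun t => a2 t ^ 2) ((2 : ℕ) * a2 t ^ (2 - 1) * a1 t) (Ioi t) t := ha2.pow 2
  have h2b : HasDerivWithinAt (fun t => b2 t ^ 2) ((2 : ℕ) * b2 t ^ (2 - 1) * b1 t) (Ioi t) t := hb2.pow 2
  have h3a : HasDerivWithinAt (fun t => a3 t ^ 2) ((2 : ℕ) * a3 t ^ (2 - 1) * a2 t) (Ioi t) t := ha3.pow 2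
  have h3b : HasDerivWithinAt (fun t => b3 t ^ 2) ((2 : ℕ) * b3 t ^ (2 - 1) * b2 t) (Ioi t) t := hb3.pow 2
  have key := ((e11.mul (h2a.add h2b)).add (e22.mul (h3a.add h3b))).add
    ((((((ha2.mul ep).mul ha3).add ((hb2.mul eq').mul ha3)).sub ((ha2.mul eq').mul hb3)).add
      ((hb2.mul ep).mul hb3)).const_mul 2)
  refine (key.congr_deriv ?_).congr_of_eventuallyEq ?_ ?_
  · unfold bdryFormDeriv; simp only [Pi.add_apply, Pi.mul_apply]; push_cast; ring
  · exact Filter.Eventually.of_forall fun s => by unfold bdryForm; simp only [Pi.add_apply, Pi.mul_apply, Pi.sub_apply]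
  · unfold bdryForm; simp only [Pi.add_apply, Pi.mul_apply, Pi.sub_apply]

/-- **Telescoping step of the certificates:** along a right-differentiable path (`a₃, b₃` with right-derivatives `a₂, b₂`;
`a₂, b₂` with right-derivatives `a₁, b₁`, the latter interval-integrable) and `C¹` coefficients `k₁₁, k₂₂, p, q`,
`∫₀ᵀ (x*Kx)′ dτ = (x*Kx)(T) − (x*Kx)(0)`. [cite: Zhang2022LandauSiegel, Prop 7.1 p.44, (8.11)–(8.12)] -/
theorem integral_bdryFormDeriv_eq {T : ℝ} (hT : 0 ≤ T)
    {k11 k22 p q dk11 dk22 dp dq a1 b1 a2 b2 a3 b3 : ℝ → ℝ}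
    (hk11 : ∀ t, HasDerivAt k11 (dk11 t) t) (hk22 : ∀ t, HasDerivAt k22 (dk22 t) t)
    (hp : ∀ t, HasDerivAt p (dp t) t) (hq : ∀ t, HasDerivAt q (dq t) t)
    (hdk11 : Continuous dk11) (hdk22 : Continuous dk22) (hdp : Continuous dp) (hdq : Continuous dq)
    (ha3 : ContinuousOn a3 (Icc 0 T)) (hb3 : ContinuousOn b3 (Icc 0 T))
    (ha2 : ContinuousOn a2 (Icc 0 T)) (hb2 : ContinuousOn b2 (Icc 0 T))
    (ha3' : ∀ t ∈ Ioo 0 T, HasDerivWithinAt a3 (a2 t) (Ioi t) t) (hb3' : ∀ t ∈ Ioo 0 T, HasDerivWithinAt b3 (b2 t) (Ioi t) t)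
    (ha2' : ∀ t ∈ Ioo 0 T, HasDerivWithinAt a2 (a1 t) (Ioi t) t) (hb2' : ∀ t ∈ Ioo 0 T, HasDerivWithinAt b2 (b1 t) (Ioi t) t)
    (ha1 : IntervalIntegrable a1 volume 0 T) (hb1 : IntervalIntegrable b1 volume 0 T) :
    ∫ t in (0:ℝ)..T, bdryFormDeriv (k11 t) (k22 t) (p t) (q t) (dk11 t) (dk22 t) (dp t) (dq t)
        (a1 t) (b1 t) (a2 t) (b2 t) (a3 t) (b3 t)
      = bdryForm (k11 T) (k22 T) (p T) (q T) (a2 T) (b2 T) (a3 T) (b3 T)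
        - bdryForm (k11 0) (k22 0) (p 0) (q 0) (a2 0) (b2 0) (a3 0) (b3 0) := by
  have ck11 : Continuous k11 := continuous_iff_continuousAt.2 fun t => (hk11 t).continuousAt
  have ck22 : Continuous k22 := continuous_iff_continuousAt.2 fun t => (hk22 t).continuousAt
  have cp : Continuous p := continuous_iff_continuousAt.2 fun t => (hp t).continuousAt
  have cq : Continuous q := continuous_iff_continuousAt.2 fun t => (hq t).continuousAt
  have hK11 := ck11.continuousOn (s := Icc 0 T); have hK22 := ck22.continuousOn (s := Icc 0 T)
  have hP := cp.continuousOn (s := Icc 0 T); have hQ := cq.continuousOn (s := Icc 0 T)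
  have hdK11 := hdk11.continuousOn (s := Icc 0 T); have hdK22 := hdk22.continuousOn (s := Icc 0 T)
  have hdP := hdp.continuousOn (s := Icc 0 T); have hdQ := hdq.continuousOn (s := Icc 0 T)
  apply intervalIntegral.integral_eq_sub_of_hasDeriv_right_of_le hT
  · -- continuity of x*Kx on [0,T]
    have hc : ContinuousOn (fun t => k11 t * (a2 t ^ 2 + b2 t ^ 2) + k22 t * (a3 t ^ 2 + b3 t ^ 2)
        + 2 * (a2 t * p t * a3 t + b2 t * q t * a3 t - a2 t * q t * b3 t + b2 t * p t * b3 t)) (Icc 0 T) :=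
      ((hK11.mul ((ha2.pow 2).add (hb2.pow 2))).add (hK22.mul ((ha3.pow 2).add (hb3.pow 2)))).add
        (continuousOn_const.mul (((((ha2.mul hP).mul ha3).add ((hb2.mul hQ).mul ha3)).sub ((ha2.mul hQ).mul hb3)).add
          ((hb2.mul hP).mul hb3)))
    exact hc.congr (fun t _ => by unfold bdryForm; ring)
  · -- right derivative on (0,T)
    intro t ht
    exact hasDerivWithinAt_bdryForm (hk11 t) (hk22 t) (hp t) (hq t) (ha3' t ht) (hb3' t ht) (ha2' t ht) (hb2' t ht)
  · -- integrability of the derivative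
    have cI : ∀ {f : ℝ → ℝ}, ContinuousOn f (Icc 0 T) → IntervalIntegrable f volume 0 T := fun hf =>
      (hf.mono (by rw [uIcc_of_le hT])).intervalIntegrable
    have mI : ∀ {f g : ℝ → ℝ}, IntervalIntegrable f volume 0 T → ContinuousOn g (Icc 0 T) →
        IntervalIntegrable (fun t => f t * g t) volume 0 T := fun hf hg =>
      hf.mul_continuousOn (hg.mono (by rw [uIcc_of_le hT]))
    -- continuous part
    have hC : IntervalIntegrable (fun t => dk11 t * (a2 t ^ 2 + b2 t ^ 2) + dk22 t * (a3 t ^ 2 + b3 t ^ 2)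
        + 2 * k22 t * (a3 t * a2 t + b3 t * b2 t)
        + 2 * (a2 t * dp t * a3 t + a2 t * p t * a2 t + b2 t * dq t * a3 t + b2 t * q t * a2 t
               - a2 t * dq t * b3 t - a2 t * q t * b2 t + b2 t * dp t * b3 t + b2 t * p t * b2 t)) volume 0 T :=
      cI ((((hdK11.mul ((ha2.pow 2).add (hb2.pow 2))).add (hdK22.mul ((ha3.pow 2).add (hb3.pow 2)))).add
            ((continuousOn_const.mul hK22).mul ((ha3.mul ha2).add (hb3.mul hb2)))).add
          (continuousOn_const.mul
            ((((((((ha2.mul hdP).mul ha3).add ((ha2.mul hP).mul ha2)).add ((hb2.mul hdQ).mul ha3)).add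
              ((hb2.mul hQ).mul ha2)).sub ((ha2.mul hdQ).mul hb3)).sub ((ha2.mul hQ).mul hb2)).add
              ((hb2.mul hdP).mul hb3) |>.add ((hb2.mul hP).mul hb2))))
    -- the a1 / b1 parts
    have hA : IntervalIntegrable (fun t => a1 t * (2 * k11 t * a2 t + 2 * (p t * a3 t - q t * b3 t))) volume 0 T :=
      mI ha1 (((continuousOn_const.mul hK11).mul ha2).add (continuousOn_const.mul ((hP.mul ha3).sub (hQ.mul hb3))))
    have hB : IntervalIntegrable (fun t => b1 t * (2 * k11 t * b2 t + 2 * (q t * a3 t + p t * b3 t))) volume 0 T :=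
      mI hb1 (((continuousOn_const.mul hK11).mul hb2).add (continuousOn_const.mul ((hQ.mul ha3).add (hP.mul hb3))))
    have hsum := (hC.add hA).add hB
    have hfun : (fun t => bdryFormDeriv (k11 t) (k22 t) (p t) (q t) (dk11 t) (dk22 t) (dp t) (dq t)
        (a1 t) (b1 t) (a2 t) (b2 t) (a3 t) (b3 t))
        = fun t => (dk11 t * (a2 t ^ 2 + b2 t ^ 2) + dk22 t * (a3 t ^ 2 + b3 t ^ 2)
        + 2 * k22 t * (a3 t * a2 t + b3 t * b2 t)
        + 2 * (a2 t * dp t * a3 t + a2 t * p t * a2 t + b2 t * dq t * a3 t + b2 t * q t * a2 t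
               - a2 t * dq t * b3 t - a2 t * q t * b2 t + b2 t * dp t * b3 t + b2 t * p t * b2 t))
        + a1 t * (2 * k11 t * a2 t + 2 * (p t * a3 t - q t * b3 t))
        + b1 t * (2 * k11 t * b2 t + 2 * (q t * a3 t + p t * b3 t)) := by
      funext t; unfold bdryFormDeriv; ring
    rw [hfun]; exact hsum

end Literature.NumberTheory.LFunctions.Zhang2022.Det.ShiftCert
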